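import Summits.MatrixMultiplication.OmegaCensus.SmallFormats.MatMul22nRankGF5PlanesData
import HarnessLib

/-!
# ω-census family (a): the `𝔽₅` capped-pair certificate (kernel-checked tables) for `R_𝔽₅(⟨2,2,n⟩) ≥ 3n + 2`

Cell `pub-omega` (unit `pub-omega-tensor-g7`), topic `Summits/MatrixMultiplication/OmegaCensus` (sub-folder
`SmallFormats`). Framing (verbatim): lottery ticket; floor = certified bounds/negative ranges. HONEST FRAMING: finite facts
about `M₂(𝔽₅)` checked by `decide`; the VALUE `R(⟨2,2,n⟩) ≥ 3n + 2` over every field is PRINTED (Alekseev 2014/2015). Nothing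
here is progress on `ω`.

THE FACTS. Call two invertible classes `{λA}, {λB} ⊂ M₂(𝔽₅)` *capped* if some dual-type or `𝔽₂₅`-type plane is annihilated by
both (for `A ≠ B` up to scalars this is the plane `span(A,B)^⊥`, which has the type of `A⁻¹B`: capped iff `A⁻¹B` does NOT have
two distinct eigenvalues in `𝔽₅`). The tables of `MatMul22nRankGF5PlanesData` certify: (i) the 344 planes are what they claim
(`jM5_ok`, …); (ii) every invertible matrix is a nonzero multiple of the representative of its code (`repF5_spec`); (iii) the
witnesses are sound (`wI5_ok`, `wD5_ok`, `wN5_ok`); (iv) every split semisimple class is conjugate (by an explicit sandwich fixing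
`I`) to a multiple of `diag(1, β+2)`, `β < 3` (`cj5_ok`); (v) every invertible class is capped with `I`, or capped with
`diag(1, β+2)`, or among the ≤ 20 listed classes (`mem5_ok`); (vi) among any four listed classes two are capped (`four5_ok`,
nested form) — i.e. the graph "uncapped" on the 120 invertible classes has clique number `5` (a clique of 6 would, after the two
normalisations, give four pairwise uncapped listed classes).
-/

namespace Summit.MatrixMultiplication.OmegaCensus.SmallFormats

open Matrix Literature.Computability.AlgebraicComplexity

/-! ## Computable primitives over `𝔽₅` -/

/-- `5` is prime (instance needed for `Field (ZMod 5)`; Mathlib registers only `2` and `3`). -/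
instance fact_prime_five_gf5 : Fact (Nat.Prime 5) := ⟨Nat.prime_five⟩

/-- The pairing `⟨A, M⟩ = ∑_b A_b M_b` over `𝔽₅`, written out. -/
def pdot5 (A : Fin 2 × Fin 2 → ZMod 5) (M : Matrix (Fin 2) (Fin 2) (ZMod 5)) : ZMod 5 :=
  A (0, 0) * M 0 0 + A (0, 1) * M 0 1 + A (1, 0) * M 1 0 + A (1, 1) * M 1 1

/-- `dotX = pdot5`. -/
theorem dotX_eq_pdot5 (A : Fin 2 × Fin 2 → ZMod 5) (M : Matrix (Fin 2) (Fin 2) (ZMod 5)) :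
    dotX A M = pdot5 A M := dotX_eq A M

/-- `2×2` determinant of a coefficient function. -/
def det2 {k : Type*} [Field k] (A : Fin 2 × Fin 2 → k) : k := A (0, 0) * A (1, 1) - A (0, 1) * A (1, 0)

set_option maxRecDepth 100000 in
/-- The un-sandwiches take `M` to `I` (`decide`). -/
theorem jM5_ok : ∀ l : Fin 144, jP5 l * jM5 l * jQ5 l = 1 := by decide +kernel
set_option maxRecDepth 100000 in
/-- The un-sandwiches take `N` to `E₀₁` (`decide`). -/
theorem jN5_ok : ∀ l : Fin 144, jP5 l * jN5 l * jQ5 l = (E01 : Matrix (Fin 2) (Fin 2) (ZMod 5)) := by decide +kernel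
set_option maxRecDepth 100000 in
/-- The un-sandwiches take `M` to `I` (`decide`). -/
theorem qM5_ok : ∀ l : Fin 200, qP5 l * qM5 l * qQ5 l = 1 := by decide +kernel
set_option maxRecDepth 100000 in
/-- The un-sandwiches take `N` to `C = !![0,1;2,0]` (`decide`). -/
theorem qN5_ok : ∀ l : Fin 200, qP5 l * qN5 l * qQ5 l = Cmat (2 : ZMod 5) 0 := by decide +kernel
/-- `t² = 2` has no root in `𝔽₅` (so `!![0,1;2,0]` has no eigenvalue). -/
theorem zmod5_sq_ne : ∀ t : ZMod 5, t * t ≠ 0 * t + 2 := by decide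

/-- The 144 dual-type planes of `M₂(𝔽₅)` as `JPlane` data. -/
def jPlane5 (l : Fin 144) : JPlane (ZMod 5) := ⟨jM5 l, jN5 l, jP5 l, jQ5 l, jM5_ok l, jN5_ok l⟩
/-- The 200 `𝔽₂₅`-type planes of `M₂(𝔽₅)` as `QPlane` data. -/
def qPlane5 (l : Fin 200) : QPlane (ZMod 5) 2 0 := ⟨qM5 l, qN5 l, qP5 l, qQ5 l, qM5_ok l, qN5_ok l⟩

/-- `A` annihilates dual-type plane `l` (Boolean test). -/
def perpJ5 (A : Fin 2 × Fin 2 → ZMod 5) (l : Fin 144) : Bool := decide (pdot5 A (jM5 l) = 0 ∧ pdot5 A (jN5 l) = 0)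
/-- `A` annihilates `𝔽₂₅`-type plane `l` (Boolean test). -/
def perpQ5 (A : Fin 2 × Fin 2 → ZMod 5) (l : Fin 200) : Bool := decide (pdot5 A (qM5 l) = 0 ∧ pdot5 A (qN5 l) = 0)

/-- A positive `perpJ5` test gives the two vanishing pairings. -/
theorem perpJ5_dotX {A : Fin 2 × Fin 2 → ZMod 5} {l : Fin 144} (h : perpJ5 A l = true) :
    dotX A (jPlane5 l).M = 0 ∧ dotX A (jPlane5 l).N = 0 := by
  rw [dotX_eq_pdot5, dotX_eq_pdot5]; exact of_decide_eq_true h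
/-- A positive `perpQ5` test gives the two vanishing pairings. -/
theorem perpQ5_dotX {A : Fin 2 × Fin 2 → ZMod 5} {l : Fin 200} (h : perpQ5 A l = true) :
    dotX A (qPlane5 l).M = 0 ∧ dotX A (qPlane5 l).N = 0 := by
  rw [dotX_eq_pdot5, dotX_eq_pdot5]; exact of_decide_eq_true h

/-- `w` is the code of a plane annihilated by `A` (`1 ≤ w ≤ 144`: dual plane `w−1`; `145 ≤ w ≤ 344`: `𝔽₂₅`-plane `w−145`). -/
def okW5 (A : Fin 2 × Fin 2 → ZMod 5) (w : ℕ) : Bool :=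
  if h : 0 < w ∧ w < 145 then perpJ5 A ⟨w - 1, by omega⟩
  else if h' : 145 ≤ w ∧ w < 345 then perpQ5 A ⟨w - 145, by omega⟩ else false

/-- Two positive `okW5` tests with the same code give a common annihilated plane. -/
theorem common_of_okW5 {A B : Fin 2 × Fin 2 → ZMod 5} {w : ℕ} (hA : okW5 A w = true) (hB : okW5 B w = true) :
    (∃ l : Fin 144, perpJ5 A l = true ∧ perpJ5 B l = true) ∨ (∃ l : Fin 200, perpQ5 A l = true ∧ perpQ5 B l = true) := by
  unfold okW5 at hA hB
  by_cases h : 0 < w ∧ w < 145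
  · rw [dif_pos h] at hA hB; exact Or.inl ⟨_, hA, hB⟩
  · rw [dif_neg h] at hA hB
    by_cases h' : 145 ≤ w ∧ w < 345
    · rw [dif_pos h'] at hA hB; exact Or.inr ⟨_, hA, hB⟩
    · rw [dif_neg h'] at hA; exact absurd hA Bool.false_ne_true

/-- `okW5` only sees `A` through `pdot5`, which is homogeneous: a multiple of `R` annihilates what `R` annihilates. -/
theorem okW5_of_eq_mul {A R : Fin 2 × Fin 2 → ZMod 5} {s : ZMod 5} (h : ∀ p, A p = s * R p) {w : ℕ}
    (hR : okW5 R w = true) : okW5 A w = true := by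
  have key : ∀ M, pdot5 R M = 0 → pdot5 A M = 0 := by
    intro M hM
    have e : pdot5 A M = s * pdot5 R M := by simp only [pdot5, h]; ring
    rw [e, hM, mul_zero]
  unfold okW5 at hR ⊢
  by_cases h1 : 0 < w ∧ w < 145
  · rw [dif_pos h1] at hR ⊢
    have h2 := of_decide_eq_true hR
    exact decide_eq_true ⟨key _ h2.1, key _ h2.2⟩
  · rw [dif_neg h1] at hR ⊢
    by_cases h3 : 145 ≤ w ∧ w < 345
    · rw [dif_pos h3] at hR ⊢
      have h2 := of_decide_eq_true hR
      exact decide_eq_true ⟨key _ h2.1, key _ h2.2⟩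
    · rw [dif_neg h3] at hR ⊢; exact hR

/-! ## Class codes -/

/-- The leading entry used to normalise an invertible matrix: `A₀₀` if nonzero, else `A₀₁`. -/
def lead5 (A : Fin 2 × Fin 2 → ZMod 5) : ZMod 5 := if A (0, 0) = 0 then A (0, 1) else A (0, 0)

/-- The class code of an invertible `A ∈ M₂(𝔽₅)` (`A / lead5 A` read off in base 5; `x⁻¹ = x³` in `𝔽₅`). -/
def code5 (A : Fin 2 × Fin 2 → ZMod 5) : Fin 150 :=
  if A (0, 0) = 0 then
    ⟨125 + 5 * (A (0, 1) ^ 3 * A (1, 0)).val + (A (0, 1) ^ 3 * A (1, 1)).val, by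
      have := (A (0, 1) ^ 3 * A (1, 0)).val_lt; have := (A (0, 1) ^ 3 * A (1, 1)).val_lt; omega⟩
  else
    ⟨25 * (A (0, 0) ^ 3 * A (0, 1)).val + 5 * (A (0, 0) ^ 3 * A (1, 0)).val + (A (0, 0) ^ 3 * A (1, 1)).val, by
      have := (A (0, 0) ^ 3 * A (0, 1)).val_lt; have := (A (0, 0) ^ 3 * A (1, 0)).val_lt
      have := (A (0, 0) ^ 3 * A (1, 1)).val_lt; omega⟩

/-- The representative of a class code. -/
def repF5 (c : Fin 150) : Fin 2 × Fin 2 → ZMod 5 :=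
  if c.val < 125 then mk4 1 ((c.val / 25 : ℕ) : ZMod 5) ((c.val / 5 % 5 : ℕ) : ZMod 5) ((c.val % 5 : ℕ) : ZMod 5)
  else mk4 0 1 (((c.val - 125) / 5 : ℕ) : ZMod 5) (((c.val - 125) % 5 : ℕ) : ZMod 5)

set_option maxRecDepth 100000 in
/-- Every invertible `A` is `lead5 A` times the representative of its code (`decide` over the 625 matrices). -/
theorem repF5_spec : ∀ A : Fin 2 × Fin 2 → ZMod 5, det2 A ≠ 0 →
    lead5 A ≠ 0 ∧ ∀ p : Fin 2 × Fin 2, A p = lead5 A * repF5 (code5 A) p :=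
  forall_of_forall_mk4 (by decide +kernel)

/-- The identity's coefficient function. -/
def idC5 : Fin 2 × Fin 2 → ZMod 5 := mk4 1 0 0 1
/-- The diagonal classes `D_β = diag(1, β+2)`, `β < 3`. -/
def D5 (b : Fin 3) : Fin 2 × Fin 2 → ZMod 5 := mk4 1 0 0 ((b.val : ZMod 5) + 2)

/-- `Pᵀ A Qᵀ` on coefficient functions, written out: the X-coefficients after the sandwich `x ↦ P x Q`. -/
def sand {k : Type*} [Field k] (P Q : Matrix (Fin 2) (Fin 2) k) (A : Fin 2 × Fin 2 → k) : Fin 2 × Fin 2 → k :=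
  fun p => P 0 p.1 * A (0, 0) * Q p.2 0 + P 0 p.1 * A (0, 1) * Q p.2 1 + P 1 p.1 * A (1, 0) * Q p.2 0 +
    P 1 p.1 * A (1, 1) * Q p.2 1

/-! ## The witness tables are sound (`decide`) -/

set_option maxRecDepth 100000 in
/-- Pairs `(I, c)`: the witness plane is annihilated by both. -/
theorem wI5_ok : ∀ c : Fin 150, det2 (repF5 c) ≠ 0 → wI5 c ≠ 0 →
    okW5 idC5 (wI5 c) = true ∧ okW5 (repF5 c) (wI5 c) = true := by decide +kernel

set_option maxRecDepth 100000 in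
/-- The second normalisation: for a class `c` sharing no plane with `I`, the sandwich `x ↦ P x P⁻¹` (`P = cjP5 c`) fixes the
identity form and takes the form `repF5 c` to `cjS5 c • D_(cjB5 c)`, `cjS5 c ≠ 0`. -/
theorem cj5_ok : ∀ c : Fin 150, det2 (repF5 c) ≠ 0 → wI5 c = 0 →
    cjPi5 c * cjP5 c = 1 ∧ cjP5 c * cjPi5 c = 1 ∧ (∀ p, sand (cjP5 c) (cjPi5 c) idC5 p = idC5 p) ∧
      (∀ p, sand (cjP5 c) (cjPi5 c) (repF5 c) p = cjS5 c * D5 (cjB5 c) p) ∧ cjS5 c ≠ 0 := by decide +kernel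

/-- The three `wD5` tables as one function. -/
def wD5 (b : Fin 3) : Fin 150 → ℕ := ![wD5_0, wD5_1, wD5_2] b
/-- The three member lists as one function. -/
def nb5 (b : Fin 3) : Fin 20 → Fin 150 := ![nb5_0, nb5_1, nb5_2] b
/-- The three `wN5` tables as one function. -/
def wN5 (b : Fin 3) : Fin 20 → Fin 20 → ℕ := ![wN5_0, wN5_1, wN5_2] b

set_option maxRecDepth 100000 in
/-- Pairs `(D_β, c)`: the witness plane is annihilated by both. -/
theorem wD5_ok : ∀ b : Fin 3, ∀ c : Fin 150, det2 (repF5 c) ≠ 0 → wD5 b c ≠ 0 →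
    okW5 (D5 b) (wD5 b c) = true ∧ okW5 (repF5 c) (wD5 b c) = true := by decide +kernel

set_option maxRecDepth 100000 in
/-- Completeness: an invertible class sharing no plane with `I` nor with `D_β` is listed in `nb5 β`. -/
theorem mem5_ok : ∀ b : Fin 3, ∀ c : Fin 150, det2 (repF5 c) ≠ 0 → wI5 c = 0 → wD5 b c = 0 →
    ∃ p : Fin 20, nb5 b p = c := by decide +kernel

set_option maxRecDepth 100000 in
/-- Pairs inside the lists: the witness plane is annihilated by both. -/
theorem wN5_ok : ∀ b : Fin 3, ∀ p p' : Fin 20, wN5 b p p' ≠ 0 →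
    okW5 (repF5 (nb5 b p)) (wN5 b p p') = true ∧ okW5 (repF5 (nb5 b p')) (wN5 b p p') = true := by decide +kernel

set_option maxRecDepth 100000 in
/-- **No four pairwise uncapped listed classes** (nested form, `decide`): clique number of "uncapped" is `5`. -/
theorem four5_ok : ∀ b : Fin 3, ∀ p₁ p₂ : Fin 20, wN5 b p₁ p₂ ≠ 0 ∨ ∀ p₃ : Fin 20, (wN5 b p₁ p₃ ≠ 0 ∨ wN5 b p₂ p₃ ≠ 0) ∨
    ∀ p₄ : Fin 20, wN5 b p₁ p₄ ≠ 0 ∨ wN5 b p₂ p₄ ≠ 0 ∨ wN5 b p₃ p₄ ≠ 0 := by decide +kernel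

end Summit.MatrixMultiplication.OmegaCensus.SmallFormats
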